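import Mathlib
import Summits.ResolutionOfSingularities.ResolutionOfSingularities.Theorems.WeightedInvariantLocalWeightedDropWildMonicFlagBoundAttain
import Summits.ResolutionOfSingularities.ResolutionOfSingularities.Theorems.WeightedInvariantLocalWeightedDropWildMonicFlagCorner
import Summits.ResolutionOfSingularities.ResolutionOfSingularities.Theorems.WeightedInvariantLocalWeightedDropWildMonicFlagCornerShift
import Summits.ResolutionOfSingularities.ResolutionOfSingularities.Theorems.WeightedInvariantLocalWeightedDropWildMonicFlagSwapReading

/-!
# `WeightedInvariant.LocalWeightedDrop`, line `hasse-ridge-face-selection`, S3ρ sub-stub S3ρD: item D-0 «a maximising flag exists» —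
# hbounds (i): at a non-exit position some VALID coordinate flag has `d_𝓕 > 0`

Crux item stmt-ResolutionOfSingularities-8899 `LocalWeightedDrop` (route `ResolutionOfSingularities/WeightedInvariant`), engine of the
door `HypersurfaceCentreConstruction` stmt-ResolutionOfSingularities-19897.  [OURS · L1 W4.3, chain w43, res-L1-w43-stub-1 (gen 4) =
second hand on roadmap item D-0 under the S3ρ owners res-type-083 / stub-7 and the D-0 holder res-L1-w43-stub-3; plan
`L/res-L1-w43-stub-1/HPOS-PLAN.md`, file F3 (assembly of F1 `…WildMonicFlagCorner` and F2 `…WildMonicFlagCornerShift` over the bound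
files `…WildMonicFlagBound(Attain)`).  MODEL: S. Perlega, thesis Wien 2017 / arXiv:2011.14443 Lemma 7.4.11 «If 𝒳 is not in a terminal
case at a and 𝓕 ∈ 𝔽 is a maximizing flag, then … d_𝓕 > 0 holds»; the route here is OURS (m-maximality in ONE class + a corner
computation instead of Perlega's three-fold cleaning of Prop. 7.4.5).  Nothing here is a statement of H. Hironaka's manuscript.]

THE ARGUMENT (class `o = false`, `h = 0`; `N(g)` = scaled Newton set of `shift d A g`, `m(g) = r₀ + r₁`, `d(g) = dRes`,
`m + d = δ(N(g)) = m_{(1,1)}`).  If every VALID `g` (`m(g) = m*`, `exists_isMMax`) had `d(g) = 0` (corner `r(g) ∈ N(g) ⊆ r(g) + ℕ²`):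
STEP 1 `m* > d!` — else valid re-centrings have order `1` and `m* = d!` (res-type-083's trichotomy), the `q`-slot puts `d!·e_i` into
`N(g)` for each non-zero linear coefficient of `g` (`single_factorial_mem_newtonSet_shift`), so `x_i^{d−j} ∣ (shift d A g)_j` survives
re-centring by `−c_i x_i` (`X_pow_dvd_shift`) and `g − c_i x_i` is valid of order `≥ 2`, contradiction; STEP 2 `shift d A g` is a
position (`isPos_iff_lt_wMin`); STEP 3 a NON-SOLVABLE corner makes it terminal (`terminal_of_corner_not_solvable`) and `(X, g)` an exit
move, a SOLVABLE one is eliminated by `g + μ x^{r/d!}` (`corner_elimination`), which is valid with `d ≥ 1`.  Hence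
**`exists_isFlagTriple_fst_pos`** = hbounds (i) of stub-3's `attainShape_of_bounds_of_attain`, and **`attainShape_isFlagTriple_of_HN_HS₀`** /
**`attainShape_isFlagTriple_of_HN_hattain₀`**: D-0 for `IsFlagTriple d` from HN (`n ≥ N ⇒ d = 0`) and the classwise `s`-attainment only.
AI-written; gate-accepted means sorry-free with standard axioms, not refereed.
-/

set_option linter.dupNamespace false -- mandated namespace of this single-conjunct summit

noncomputable section

namespace Summit.ResolutionOfSingularities.ResolutionOfSingularities.Theorems

namespace WildMonic

open MvPowerSeries MonicDescent
open Literature.AlgebraicGeometry.Resolution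
open Literature.AlgebraicGeometry.Resolution.HauserPerlega2024 (Triple)
open PurePowerFlag (swap swapE orient orientE IsN0 IsTangent)

variable {k : Type} [Field k] {d : ℕ}

/-! ### The coordinate class `(o, h) = (false, 0)` -/

/-- `m` of a coordinate-class flag: `r₀ + r₁` of the re-centred tuple. -/
theorem mOf_zero_right (A : Fin d → MvPowerSeries (Fin 2) k) (E : Finset (Fin 2)) (g : MvPowerSeries (Fin 2) k) :
    mOf d A E g 0 = excExp E (newtonSet (shift d A g)) 0 + excExp E (newtonSet (shift d A g)) 1 := by
  rw [mOf_of_isN0 (Or.inr rfl), flagTuple_zero_shear]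

/-- `d` of a coordinate-class flag: `dRes` of the re-centred tuple. -/
theorem flagTriple_zero_right_fst (A : Fin d → MvPowerSeries (Fin 2) k) (E : Finset (Fin 2)) (g : MvPowerSeries (Fin 2) k) :
    (ofLex (flagTriple d A E g 0)).1 = dRes E (newtonSet (shift d A g)) := by
  rw [flagTriple_of_isN0 (Or.inr rfl), flagTuple_zero_shear]
  rfl

/-- The trichotomy of res-type-083 as a lower bound: `min (m(A), d!·ord g) ≤ m(shift d A g)` (scaled `(1,1)`-orders). -/
theorem min_le_wMin_shift (hd : 0 < d) (A : Fin d → MvPowerSeries (Fin 2) k) (g : MvPowerSeries (Fin 2) k) :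
    min (wMin (fun _ => 1) A) ((d.factorial : ℕ∞) * g.order) ≤ wMin (fun _ => 1) (shift d A g) := by
  rcases le_or_gt (wMin (fun _ => (1 : ℕ)) A) ((d.factorial : ℕ∞) * g.weightedOrder (fun _ => 1)) with hle | hlt
  · exact (min_le_left _ _).trans (wMin_le_wMin_shift (fun _ => 1) A g hle)
  · rw [wMin_shift_eq_of_gt (fun _ => 1) A g hd hlt]
    exact min_le_right _ _

/-! ### `Fin 2` bookkeeping -/

/-- A vector below `n·e_i` with total `n` has `i`-th entry `n`. -/
theorem fin_two_apply_eq_of_le_single {r : Fin 2 →₀ ℕ} {i : Fin 2} {n : ℕ} (hsum : r 0 + r 1 = n)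
    (hle : ∀ t, r t ≤ Finsupp.single i n t) : r i = n := by
  have h0 := hle 0
  have h1 := hle 1
  fin_cases i
  · simp at h0 h1 ⊢; omega
  · simp at h0 h1 ⊢; omega

/-- A vector below `n·e_i` vanishes off `i`. -/
theorem fin_two_apply_eq_zero_of_le_single {r : Fin 2 →₀ ℕ} {i t : Fin 2} {n : ℕ}
    (hle : ∀ t, r t ≤ Finsupp.single i n t) (ht : t ≠ i) : r t = 0 := by
  have h0 := hle 0
  have h1 := hle 1
  fin_cases i <;> fin_cases t
  · exact absurd rfl ht
  · simp at h0 h1 ⊢; omega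
  · simp at h0 h1 ⊢; omega
  · exact absurd rfl ht

/-- `n ≤ P_i` gives the componentwise bound `n·e_i ≤ P`. -/
theorem single_apply_le_of_le_apply {P : Fin 2 →₀ ℕ} {i : Fin 2} {n : ℕ} (h : n ≤ P i) :
    Finsupp.single i n 0 ≤ P 0 ∧ Finsupp.single i n 1 ≤ P 1 := by
  fin_cases i
  · simp at h; simp [h]
  · simp at h; simp [h]

/-- `n ≤ r_i` gives `n ≤ r₀ + r₁`. -/
theorem le_add_of_le_apply_fin_two {r : Fin 2 →₀ ℕ} {i : Fin 2} {n : ℕ} (h : n ≤ r i) : n ≤ r 0 + r 1 := by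
  fin_cases i
  · simp at h; omega
  · simp at h; omega

/-! ### hbounds (i) -/

section HPos

variable (p : ℕ) [Fact p.Prime] [CharP k p] [PerfectRing k p]

/-- **SOME VALID COORDINATE FLAG HAS `d_𝓕 > 0`** at a position that no free move puts in an exit (class `o = false`, `h = 0`, any
boundary). [cite: Perlega2020, Lemma 7.4.11 (arXiv:2011.14443 chunks p0094 L67, p0095 L1–L3)] -/
theorem exists_isMMax_dRes_pos (hd : 0 < d) {A : Fin d → MvPowerSeries (Fin 2) k} (hA : IsPos d A) (hex : ¬ Exit₃ p d A)
    (E : Finset (Fin 2)) :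
    ∃ g : MvPowerSeries (Fin 2) k, constantCoeff g = 0 ∧ IsMMax d A E g 0 ∧ 0 < dRes E (newtonSet (shift d A g)) := by
  classical
  by_contra hneg
  push Not at hneg
  -- `hneg : ∀ g, g(0) = 0 → IsMMax d A E g 0 → dRes E (newtonSet (shift d A g)) = 0` (as `≤ 0`)
  have H : ∀ g : MvPowerSeries (Fin 2) k, constantCoeff g = 0 → IsMMax d A E g 0 → dRes E (newtonSet (shift d A g)) = 0 :=
    fun g hg hv => Nat.le_zero.mp (hneg g hg hv)
  -- a valid re-centring exists; `M* := m(g*)`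
  obtain ⟨gs, hgs0, hgsmax⟩ := exists_isMMax p hd hA hex E false (h := 0) (map_zero _)
  rw [orientT_false, PurePowerFlag.orientE_false] at hgsmax
  set Ms := mOf d A E gs 0 with hMsdef
  have hvalid_of_le : ∀ g : MvPowerSeries (Fin 2) k, Ms ≤ mOf d A E g 0 → IsMMax d A E g 0 :=
    fun g hle g' hg' => (hgsmax g' hg').trans hle
  have hle_Ms : ∀ g : MvPowerSeries (Fin 2) k, constantCoeff g = 0 → mOf d A E g 0 ≤ Ms := fun g hg => hgsmax g hg
  -- basic facts at a valid `g`
  have hm₀ : ((d.factorial : ℕ) : ℕ∞) < wMin (fun _ => 1) A := (isPos_iff_lt_wMin A).mp hA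
  have hXA : (fun j => subst (X : Fin 2 → MvPowerSeries (Fin 2) k) (A j)) = A := funext fun j => congrFun subst_self (A j)
  have hne : ∀ g : MvPowerSeries (Fin 2) k, constantCoeff g = 0 → shift d A g ≠ 0 := by
    intro g hg h0
    exact hex (exit₃_of_shift_eq_zero p hg h0)
  have hfacts : ∀ g : MvPowerSeries (Fin 2) k, constantCoeff g = 0 → IsMMax d A E g 0 →
      (newtonSet (shift d A g)).Nonempty ∧ excExp E (newtonSet (shift d A g)) ∈ newtonSet (shift d A g) ∧
        mOf d A E g 0 = Ms ∧ wMin (fun _ => 1) (shift d A g) = (Ms : ℕ∞) := by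
    intro g hg hv
    have hN : (newtonSet (shift d A g)).Nonempty := newtonSet_nonempty (hne g hg)
    have h0 := H g hg hv
    have hm : mOf d A E g 0 = Ms := le_antisymm (hle_Ms g hg) (hv gs hgs0)
    refine ⟨hN, excExp_mem_of_dRes_eq_zero hN h0, hm, ?_⟩
    rw [wMin_eq_deltaL_newtonSet hN, ← dRes_add_excExp E hN, h0, zero_add, ← mOf_zero_right, hm]
  -- STEP 1: `d! < M*`
  have hstep1 : d.factorial < Ms := by
    by_contra hMs
    push Not at hMs
    -- every valid `g` has `ord g = 1` (and then `M* = d!`)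
    have hord : ∀ g : MvPowerSeries (Fin 2) k, constantCoeff g = 0 → IsMMax d A E g 0 → g.order = 1 := by
      intro g hg hv
      obtain ⟨-, -, -, hw⟩ := hfacts g hg hv
      have hmin := min_le_wMin_shift hd A g
      rw [hw] at hmin
      have hlt : min (wMin (fun _ => 1) A) ((d.factorial : ℕ∞) * g.order) < wMin (fun _ => 1) A :=
        lt_of_le_of_lt hmin (lt_of_le_of_lt (by exact_mod_cast hMs) hm₀)
      have hcase : ((d.factorial : ℕ∞) * g.order) ≤ (Ms : ℕ∞) := by
        rcases min_choice (wMin (fun _ => 1) A) ((d.factorial : ℕ∞) * g.order) with h | h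
        · rw [h] at hlt; exact absurd hlt (lt_irrefl _)
        · rw [h] at hmin; exact hmin
      have h1 : (1 : ℕ∞) ≤ g.order := one_le_order_iff_constCoeff_eq_zero.mpr hg
      have hle1 : g.order ≤ 1 := by
        by_contra hgt
        push Not at hgt
        have h2 : (2 : ℕ∞) ≤ g.order := Order.add_one_le_of_lt hgt
        have : ((2 * d.factorial : ℕ) : ℕ∞) ≤ (Ms : ℕ∞) := by
          calc ((2 * d.factorial : ℕ) : ℕ∞) = (d.factorial : ℕ∞) * 2 := by push_cast; ring
            _ ≤ (d.factorial : ℕ∞) * g.order := by gcongr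
            _ ≤ _ := hcase
        have : 2 * d.factorial ≤ Ms := by exact_mod_cast this
        have := Nat.factorial_pos d
        omega
      exact le_antisymm hle1 h1
    -- at `g*`: one linear coefficient is non-zero
    have hord1 := hord gs hgs0 hgsmax
    obtain ⟨hN, hcorner, -, hw⟩ := hfacts gs hgs0 hgsmax
    have hMs_eq : Ms = d.factorial := by
      have hmin := min_le_wMin_shift hd A gs
      rw [hw, hord1, mul_one, min_eq_right hm₀.le] at hmin
      exact le_antisymm hMs (by exact_mod_cast hmin)
    have hsum : excExp E (newtonSet (shift d A gs)) 0 + excExp E (newtonSet (shift d A gs)) 1 = d.factorial := by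
      rw [← hMs_eq]
      exact (mOf_zero_right A E gs).symm.trans (hfacts gs hgs0 hgsmax).2.2.1
    have hlin : ∃ i : Fin 2, coeff (Finsupp.single i 1) gs ≠ 0 := by
      by_contra hall
      push Not at hall
      have h2 : (2 : ℕ∞) ≤ gs.order := (FormalCoordChange.two_le_order_iff gs).mpr ⟨hgs0, hall⟩
      rw [hord1] at h2
      exact absurd h2 (by decide)
    obtain ⟨i, hci⟩ := hlin
    -- the axis point `d!·e_i` is a Newton point, so `r = d!·e_i`, `i ∈ E`, and the other linear coefficient vanishes
    have haxis : ∀ i' : Fin 2, coeff (Finsupp.single i' 1) gs ≠ 0 →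
        ∀ t, excExp E (newtonSet (shift d A gs)) t ≤ Finsupp.single i' d.factorial t := by
      intro i' hci' t
      exact excExp_le (E := E) (single_factorial_mem_newtonSet_shift p hd hA hgs0 hci') t
    have hri : excExp E (newtonSet (shift d A gs)) i = d.factorial := fin_two_apply_eq_of_le_single hsum (haxis i hci)
    have hiE : i ∈ E := by
      by_contra hiE
      rw [excExp_eq_zero_of_not_mem hiE] at hri
      exact absurd hri.symm (Nat.factorial_pos d).ne'
    have hother : ∀ i' : Fin 2, i' ≠ i → coeff (Finsupp.single i' 1) gs = 0 := by
      intro i' hi'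
      by_contra hci'
      have hri' : excExp E (newtonSet (shift d A gs)) i' = d.factorial := fin_two_apply_eq_of_le_single hsum (haxis i' hci')
      have hzero : excExp E (newtonSet (shift d A gs)) i' = 0 := fin_two_apply_eq_zero_of_le_single (haxis i hci) hi'
      rw [hzero] at hri'
      exact absurd hri' (Nat.factorial_pos d).ne
    -- `x_i^{d-j}` divides every slot of `shift d A g*`
    have hdiv : ∀ j : Fin d, X i ^ ((d - (j : ℕ)) * 1) ∣ shift d A gs j := by
      rw [← forall_newtonSet_le_iff_X_pow_dvd]
      intro P hP
      rw [mul_one, ← hri]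
      exact excExp_le hP i
    -- re-centre by `−c_i x_i`: the remainder `g₂`
    set g₂ : MvPowerSeries (Fin 2) k := -(C (coeff (Finsupp.single i 1) gs) * X i) + gs with hg₂def
    have hg₂0 : constantCoeff g₂ = 0 := by simp [hg₂def, hgs0]
    have hg₂ord : (2 : ℕ∞) ≤ g₂.order := by
      rw [FormalCoordChange.two_le_order_iff]
      refine ⟨hg₂0, fun l => ?_⟩
      by_cases hl : l = i
      · subst hl; simp [hg₂def, coeff_X]
      · simp [hg₂def, coeff_X, Finsupp.single_eq_single_iff, hl, hother l hl]
    have hshift : shift d A g₂ = shift d (shift d A gs) (-(C (coeff (Finsupp.single i 1) gs) * X i)) := by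
      rw [shift_shift]
    have hdiv₂ : ∀ j : Fin d, X i ^ ((d - (j : ℕ)) * 1) ∣ shift d A g₂ j := by
      intro j
      rw [hshift]
      refine X_pow_dvd_shift hdiv ?_ j
      rw [pow_one]
      exact (dvd_mul_left (X i) _).neg_right
    have hN₂ : (newtonSet (shift d A g₂)).Nonempty := newtonSet_nonempty (hne g₂ hg₂0)
    have hpts : ∀ P ∈ newtonSet (shift d A g₂), d.factorial * 1 ≤ P i := (forall_newtonSet_le_iff_X_pow_dvd _ i 1).mpr hdiv₂
    have hexc₂ : d.factorial ≤ excExp E (newtonSet (shift d A g₂)) i := by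
      have h := le_excExp_of_forall_le (E := E) hN₂ (s := Finsupp.single i d.factorial)
        (fun P hP => single_apply_le_of_le_apply (by have hPi := hpts P hP; rwa [mul_one] at hPi)) i hiE
      simpa using h
    have hvalid₂ : IsMMax d A E g₂ 0 := by
      refine hvalid_of_le g₂ ?_
      rw [hMs_eq, mOf_zero_right]
      exact le_add_of_le_apply_fin_two hexc₂
    have hord₂ := hord g₂ hg₂0 hvalid₂
    rw [hord₂] at hg₂ord
    exact absurd hg₂ord (by decide)
  -- STEP 2/3 at `g*`
  obtain ⟨hN, hcorner, hmgs, hw⟩ := hfacts gs hgs0 hgsmax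
  have hrsum : excExp E (newtonSet (shift d A gs)) 0 + excExp E (newtonSet (shift d A gs)) 1 = Ms :=
    (mOf_zero_right A E gs).symm.trans hmgs
  set B := shift d A gs with hBdef
  set r := excExp E (newtonSet B) with hrdef
  have hposB : IsPos d B := by
    rw [isPos_iff_lt_wMin, hw]
    exact_mod_cast hstep1
  have hdomB : ∀ P ∈ newtonSet B, r 0 ≤ P 0 ∧ r 1 ≤ P 1 := fun P hP => ⟨excExp_le hP 0, excExp_le hP 1⟩
  by_cases hsolv : d.factorial ∣ r 0 ∧ d.factorial ∣ r 1 ∧ ∃ μ : k, ∀ j : Fin d,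
      coeff (Finsupp.single 0 ((d - (j : ℕ)) * r 0 / d.factorial) + Finsupp.single 1 ((d - (j : ℕ)) * r 1 / d.factorial)) (B j) =
        ((d.choose (j : ℕ) : ℕ) : k) * (-μ) ^ (d - (j : ℕ))
  swap
  · -- (a) non-solvable corner: `B` is terminal and `(X, g*)` is a free move into an exit
    have hns : d.factorial ∣ r 0 → d.factorial ∣ r 1 → ∀ μ : k, ∃ j : Fin d,
        coeff (Finsupp.single 0 ((d - (j : ℕ)) * r 0 / d.factorial) + Finsupp.single 1 ((d - (j : ℕ)) * r 1 / d.factorial)) (B j) ≠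
          ((d.choose (j : ℕ) : ℕ) : k) * (-μ) ^ (d - (j : ℕ)) := by
      intro h0 h1 μ
      by_contra hall
      push Not at hall
      exact hsolv ⟨h0, h1, μ, hall⟩
    have hT : Terminal d B := terminal_of_corner_not_solvable hcorner hdomB hns
    refine hex ⟨X, gs, fun i => constantCoeff_X i, by rw [PurePowerFlag.linMat_X_det]; exact isUnit_one, hgs0, ?_, ?_⟩
    · rw [hXA]; exact hposB
    · rw [hXA]; exact Or.inl (Or.inl hT)
  · -- (b) solvable corner: eliminate it
    obtain ⟨h0, h1, μ, hμ⟩ := hsolv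
    set v : Fin 2 →₀ ℕ := Finsupp.single 0 (r 0 / d.factorial) + Finsupp.single 1 (r 1 / d.factorial) with hvdef
    have hv0 : d.factorial * v 0 = r 0 := by simp [hvdef, Nat.mul_div_cancel' h0]
    have hv1 : d.factorial * v 1 = r 1 := by simp [hvdef, Nat.mul_div_cancel' h1]
    have hvr : d.factorial • v = r := by
      ext l; fin_cases l
      · simpa using hv0
      · simpa using hv1
    have hrpos : 0 < r 0 + r 1 := by
      have := Nat.factorial_pos d
      omega
    have hvne : v ≠ 0 := by
      intro hv
      rw [hv, smul_zero] at hvr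
      rw [← hvr] at hrpos
      simp at hrpos
    -- hypotheses of `corner_elimination`
    have hdom' : ∀ (l : Fin d) (β : Fin 2 →₀ ℕ), coeff β (B l) ≠ 0 → (d - (l : ℕ)) • v ≤ β := by
      intro l β hβ
      rw [← factorial_smul_le_slotWeight_smul_iff, hvr]
      intro t
      exact excExp_le (smul_mem_newtonSet B l hβ) t
    have hexp : ∀ l : Fin d, (d - (l : ℕ)) • v =
        Finsupp.single 0 ((d - (l : ℕ)) * r 0 / d.factorial) + Finsupp.single 1 ((d - (l : ℕ)) * r 1 / d.factorial) := by
      intro l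
      ext t
      rw [Finsupp.smul_apply, smul_eq_mul, Finsupp.add_apply]
      match t with
      | 0 => simp [Nat.mul_div_assoc _ h0]
      | 1 => simp [Nat.mul_div_assoc _ h1]
    have hcorner' : ∀ l : Fin d, coeff ((d - (l : ℕ)) • v) (B l) = ((d.choose (l : ℕ) : ℕ) : k) * (-μ) ^ (d - (l : ℕ)) := by
      intro l
      rw [hexp l]
      exact hμ l
    set g' : MvPowerSeries (Fin 2) k := monomial v μ + gs with hg'def
    have hg'0 : constantCoeff g' = 0 := by
      rw [hg'def, map_add, hgs0, add_zero, ← coeff_zero_eq_constantCoeff, coeff_monomial, if_neg (Ne.symm hvne)]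
    have hB' : shift d A g' = shift d B (monomial v μ) := by rw [hBdef, shift_shift]
    have helim := corner_elimination hdom' hcorner'
    -- `g'` is valid: its Newton points dominate `r`
    have hN' : (newtonSet (shift d A g')).Nonempty := newtonSet_nonempty (hne g' hg'0)
    have hdomN' : ∀ P ∈ newtonSet (shift d A g'), r 0 ≤ P 0 ∧ r 1 ≤ P 1 := by
      rintro P ⟨j, e, he, rfl⟩
      rw [hB'] at he
      have hle : d.factorial • v ≤ slotWeight d j • e := (factorial_smul_le_slotWeight_smul_iff j v e).mpr (helim j e he).1
      rw [hvr] at hle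
      exact ⟨hle 0, hle 1⟩
    have hexc' : ∀ t : Fin 2, r t ≤ excExp E (newtonSet (shift d A g')) t := by
      intro t
      by_cases ht : t ∈ E
      · exact le_excExp_of_forall_le hN' hdomN' t ht
      · rw [hrdef, excExp_eq_zero_of_not_mem ht]; exact Nat.zero_le _
    have hm' : Ms ≤ mOf d A E g' 0 := by
      rw [mOf_zero_right]
      have := hexc' 0
      have := hexc' 1
      omega
    have hvalid' : IsMMax d A E g' 0 := hvalid_of_le g' hm'
    obtain ⟨-, hcorner'', hm'', -⟩ := hfacts g' hg'0 hvalid'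
    -- the new corner equals `r`, but `r` is no longer a Newton point
    have hr' : excExp E (newtonSet (shift d A g')) = r := by
      rw [mOf_zero_right] at hm''
      have h0' := hexc' 0
      have h1' := hexc' 1
      ext t
      fin_cases t
      · show excExp E (newtonSet (shift d A g')) 0 = r 0
        omega
      · show excExp E (newtonSet (shift d A g')) 1 = r 1
        omega
    rw [hr'] at hcorner''
    obtain ⟨j, e, he, hre⟩ := hcorner''
    rw [hB'] at he
    have heq : (d - (j : ℕ)) • v = e := (factorial_smul_eq_slotWeight_smul_iff j v e).mp (by rw [hvr]; exact hre)
    exact (helim j e he).2 heq.symm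

/-- **hbounds (i) OF `attainShape_of_bounds_of_attain` FOR `Φ := IsFlagTriple d`**: at a position that no free move puts in an exit,
some flag triple has `d > 0`. [cite: Perlega2020, Lemma 7.4.11 (arXiv:2011.14443 chunk p0094 L67)] -/
theorem exists_isFlagTriple_fst_pos (hd : 0 < d) {A : Fin d → MvPowerSeries (Fin 2) k} (hA : IsPos d A) (hex : ¬ Exit₃ p d A)
    (E : Finset (Fin 2)) : ∃ v, IsFlagTriple d A E v ∧ 0 < (ofLex v).1 := by
  obtain ⟨g, hg, hmax, hpos⟩ := exists_isMMax_dRes_pos p hd hA hex E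
  refine ⟨flagTriple d A E g 0, isFlagTriple_of_first hg (map_zero _) (Or.inl (Or.inr rfl)) hmax, ?_⟩
  rw [flagTriple_zero_right_fst]
  exact hpos

/-- **D-0 FOR `IsFlagTriple d` FROM THE TWO REMAINING ANALYTIC PIECES**: HN (`n ≥ N ⇒ d = 0`; Per17 Prop. 7.4.8 (2)) and HS₀ (every
inhabited class of `n = 0` triples with `d = D > 0` has a member with finite `s` dominating the class; Per17 Props. 7.4.5 (3) / 7.4.6
with Prop. 5.3.5 and Lemma 7.4.11) — hbounds (i) and (ii) being PROVED (`exists_isFlagTriple_fst_pos`,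
`exists_forall_isFlagTriple_fst_le`). [cite: Perlega2020, Prop. 7.4.10 (arXiv:2011.14443 chunk p0094 L60)] -/
theorem attainShape_isFlagTriple_of_HN_HS₀ (hd : 0 < d)
    (hN : ∀ (A : Fin d → MvPowerSeries (Fin 2) k) (E : Finset (Fin 2)), IsPos d A → ¬ Exit₃ p d A →
      ∃ N : ℕ, ∀ v, IsFlagTriple d A E v → N ≤ (ofLex (ofLex v).2).1 → (ofLex v).1 = 0)
    (hs₀ : ∀ (A : Fin d → MvPowerSeries (Fin 2) k) (E : Finset (Fin 2)), IsPos d A → ¬ Exit₃ p d A →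
      ∀ D : ℕ, 0 < D → (∃ v, IsFlagTriple d A E v ∧ (ofLex v).1 = D ∧ (ofLex (ofLex v).2).1 = 0) →
        ∃ v, IsFlagTriple d A E v ∧ (ofLex v).1 = D ∧ (ofLex (ofLex v).2).1 = 0 ∧ (ofLex (ofLex v).2).2 ≠ ⊤ ∧
          ∀ w, IsFlagTriple d A E w → (ofLex w).1 = D → (ofLex (ofLex w).2).1 = 0 →
            (ofLex (ofLex w).2).2 ≤ (ofLex (ofLex v).2).2) :
    AttainShape (k := k) (IsFlagTriple d) p :=
  attainShape_isFlagTriple_of_pieces p hd (fun _ E hA hex => exists_isFlagTriple_fst_pos p hd hA hex E) hN hs₀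

/-- **D-0 FOR `IsFlagTriple d` AGAINST STUB-3's REDUCTION `attainShape_isFlagTriple_of`**: with hbounds (i) and (ii) PROVED, the maximising
flag exists as soon as HN (`n ≥ N ⇒ d = 0`) and `s`-ATTAINMENT IN THE TOP CLASS WHEN IT IS AN `n = 0` CLASS (stub-3's `hattain₀`) are
supplied. [cite: Perlega2020, Prop. 7.4.10 (arXiv:2011.14443 chunk p0094 L60)] -/
theorem attainShape_isFlagTriple_of_HN_hattain₀ (hd : 0 < d)
    (hN : ∀ (A : Fin d → MvPowerSeries (Fin 2) k) (E : Finset (Fin 2)), IsPos d A → ¬ Exit₃ p d A →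
      ∃ N : ℕ, ∀ v, IsFlagTriple d A E v → N ≤ (ofLex (ofLex v).2).1 → (ofLex v).1 = 0)
    (hattain₀ : ∀ (A : Fin d → MvPowerSeries (Fin 2) k) (E : Finset (Fin 2)), IsPos d A → ¬ Exit₃ p d A →
      ∀ D : ℕ, 0 < D → (∃ v, IsFlagTriple d A E v ∧ (ofLex v).1 = D ∧ (ofLex (ofLex v).2).1 = 0) →
        (∀ w, IsFlagTriple d A E w → (ofLex w).1 ≤ D) → (∀ w, IsFlagTriple d A E w → (ofLex w).1 = D → (ofLex (ofLex w).2).1 = 0) →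
        ∃ v, IsFlagTriple d A E v ∧ (ofLex v).1 = D ∧ (ofLex (ofLex v).2).1 = 0 ∧ (ofLex (ofLex v).2).2 ≠ ⊤ ∧
          ∀ w, IsFlagTriple d A E w → (ofLex w).1 = D → (ofLex (ofLex w).2).1 = 0 → (ofLex (ofLex w).2).2 ≤ (ofLex (ofLex v).2).2) :
    AttainShape (IsFlagTriple (k := k) d) p :=
  attainShape_isFlagTriple_of p
    (fun _ E hA hex => ⟨exists_isFlagTriple_fst_pos p hd hA hex E, exists_forall_isFlagTriple_fst_le p hd hA hex E, hN _ E hA hex⟩)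
    hattain₀

end HPos

end WildMonic

end Summit.ResolutionOfSingularities.ResolutionOfSingularities.Theorems

end
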